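import Literature.NumberTheory.EllipticCurves.CuspFormLFunction
import Literature.NumberTheory.EllipticCurves.NewformsLevelEqOfHeckeEigenvalueEqProofs
import Literature.NumberTheory.EllipticCurves.NewformsEqOfHeckeEigenvalueEqProofs
import Literature.NumberTheory.EllipticCurves.NewformsCoeffFieldHolds
import Literature.NumberTheory.EllipticCurves.PAdicLFunctionDistributionProofs
import Literature.NumberTheory.EllipticCurves.LFunctionPrimeCoeff
import Literature.NumberTheory.EllipticCurves.ModularityVersionApProofs
import Literature.NumberTheory.EllipticCurves.GlobalMinimalModel
import HarnessLib

/-!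
# BirchSwinnertonDyer / ShadowIsolation — crux `IsolationOfAccidentalZeros`
# (stmt-BirchSwinnertonDyer-15786), line `birth`, stub **K** `stub_depthRigidity`

Registered stub **K** ("depth rigidity") of the skeleton
`Cruxes/IsolationOfAccidentalZeros/Lines/birth.lean`: GIVEN the Modularity Theorem
(`exists_isNewformOf`, taken as the first hypothesis), a FIXED newform `g ∈ S₂(Γ₀(N_W·M))` whose
`q`-expansion is not the sequence `(aₘ(W))ₘ` of `L`-coefficients of the globally minimal elliptic
curve `W/ℚ` is congruent to `W` only to bounded `p`-adic depth: there is `n` (depending on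
`W, p, M, g` only) such that no ring homomorphism `φ : R → ℤ/pⁿ` on a subring `R ⊆ ℂ` containing the
Hecke eigenvalues `a_ℓ(g)`, `ℓ ∤ N_W·M`, maps every such `a_ℓ(g)` to `a_ℓ(W) = frobeniusTrace W ℓ`.

Proof (Atkin–Lehner strong multiplicity one + Shimura integrality; every input is proved in the
tree except modularity, which is the hypothesis).
* Either some prime `ℓ₀ ∤ N_W·M` has `a_{ℓ₀}(g) ≠ a_{ℓ₀}(W)`. Then `x := a_{ℓ₀}(g) − a_{ℓ₀}(W)` is a
  non-zero algebraic integer (`IsNewform0.heckeEigenvalue_eq_coeff_holds`,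
  `IsNewform0.isIntegral_coeff_holds`); its minimal polynomial `Q ∈ ℤ[X]` has `Q(0) ≠ 0`
  (`stubK_minpoly_coeff_zero_ne_zero`), and if `φ(x) = 0` in `ℤ/pⁿ` then
  `Q(0) ≡ Q(φ x) = φ(Q(x)) = 0`, i.e. `pⁿ ∣ Q(0)`; so `n := |Q(0)| < pⁿ` is an admissible depth
  (`stubK_exists_depth_of_isIntegral_ne_zero`).
* Or `a_ℓ(g) = a_ℓ(W)` for every prime `ℓ ∤ N_W·M`. With the newform `f` of `W` (modularity:
  `aₘ(f) = aₘ(W)`), for such `ℓ` one has `a_ℓ(f) = a_ℓ(W)`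
  (`WeierstrassCurve.LFunction_apply_prime_eq_frobeniusTrace`, good reduction at `ℓ ∤ N_W` by
  `WeierstrassCurve.dvd_conductorNorm_iff_not_hasGoodReductionAtPrime`), so the Hecke eigenvalues
  of `f` and `g` agree off the finite set of prime divisors of `N_W·M`; strong multiplicity one
  across levels and at one level (`IsNewform0.level_eq_of_heckeEigenvalue_eq_holds`,
  `IsNewform0.eq_of_heckeEigenvalue_eq_holds`) gives `N_W·M = N_W` and `g = f`
  (`stubK_qExpansion_coeff_eq_of_heckeEigenvalue_eq`), contradicting the `q`-expansion mismatch
  (`stubK_qExpansion_coeff_eq_of_forall_heckeEigenvalue_eq`).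
-/

set_option linter.dupNamespace false

noncomputable section

namespace Summit.BirchSwinnertonDyer.BirchSwinnertonDyer.Theorems

open scoped MatrixGroups ModularForm
open CongruenceSubgroup UpperHalfPlane
open Literature.NumberTheory.EllipticCurves Literature.NumberTheory.EllipticCurves.ModularForms
open Polynomial

/-! ## The algebraic half: a non-zero algebraic integer is not `p`-adically divisible -/

/-- The minimal polynomial over `ℤ` of a non-zero element `x` of `ℂ` integral over `ℤ` has
non-zero constant coefficient: otherwise `minpoly ℤ x = X · Q'` with `Q'` monic of smaller degree
and `Q'(x) = 0` (as `x ≠ 0` and `ℂ` is a domain), contradicting minimality (`minpoly.min`).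
[folklore] -/
theorem stubK_minpoly_coeff_zero_ne_zero {x : ℂ} (hx : IsIntegral ℤ x) (hx0 : x ≠ 0) :
    (minpoly ℤ x).coeff 0 ≠ 0 := by
  intro h0
  have hQm : (minpoly ℤ x).Monic := minpoly.monic hx
  have hsplit : X * (minpoly ℤ x).divX = minpoly ℤ x := by
    have h := X_mul_divX_add (minpoly ℤ x)
    rwa [h0, map_zero, add_zero] at h
  have hQ'm : (minpoly ℤ x).divX.Monic :=
    monic_X.of_mul_monic_left (hsplit.symm ▸ hQm)
  have hQ'root : aeval x (minpoly ℤ x).divX = 0 := by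
    have h := minpoly.aeval ℤ x
    rw [← hsplit, map_mul, aeval_X, mul_eq_zero] at h
    exact h.resolve_left hx0
  have hdeg : (minpoly ℤ x).divX.degree < (minpoly ℤ x).degree :=
    degree_divX_lt (minpoly.ne_zero hx)
  exact (minpoly.min ℤ x hQ'm hQ'root).not_gt hdeg

/-- **Bounded depth of a non-zero algebraic integer.** If `x ∈ ℂ` is integral over `ℤ` and
`x ≠ 0`, then for `n := |Q(0)|`, `Q = minpoly ℤ x`, no ring homomorphism `φ : R → ℤ/pⁿ` from a
subring `R ⊆ ℂ` containing `x` kills `x`: from `Q(x) = 0` in `R` one gets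
`Q(0) = Q(φ x) = φ(Q(x)) = 0` in `ℤ/pⁿ`, i.e. `pⁿ ∣ Q(0) ≠ 0`, impossible as `|Q(0)| = n < pⁿ`.
[folklore] -/
theorem stubK_exists_depth_of_isIntegral_ne_zero (p : ℕ) [Fact p.Prime] {x : ℂ}
    (hx : IsIntegral ℤ x) (hx0 : x ≠ 0) :
    ∃ n : ℕ, ∀ (R : Subring ℂ) (φ : R →+* ZMod (p ^ n)) (hxR : x ∈ R), φ ⟨x, hxR⟩ ≠ 0 := by
  have hc : (minpoly ℤ x).coeff 0 ≠ 0 := stubK_minpoly_coeff_zero_ne_zero hx hx0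
  refine ⟨((minpoly ℤ x).coeff 0).natAbs, fun R φ hxR h0 ↦ ?_⟩
  -- `Q(x) = 0` already holds in the subring `R`
  have hy : aeval (⟨x, hxR⟩ : R) (minpoly ℤ x) = 0 := by
    have h := aeval_algHom_apply R.subtype.toIntAlgHom (⟨x, hxR⟩ : R) (minpoly ℤ x)
    rw [RingHom.toIntAlgHom_apply, Subring.subtype_apply, minpoly.aeval] at h
    exact (Subring.coe_eq_zero_iff R).mp h.symm
  -- apply `φ`: `Q(φ x) = 0`, and `φ x = 0`
  have hz : aeval (φ ⟨x, hxR⟩) (minpoly ℤ x) = 0 := by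
    rw [← RingHom.toIntAlgHom_apply, aeval_algHom_apply, hy, map_zero]
  rw [h0, ← coeff_zero_eq_aeval_zero', algebraMap_int_eq, Int.coe_castRingHom,
    ZMod.intCast_zmod_eq_zero_iff_dvd, Int.natCast_dvd] at hz
  exact (Nat.le_of_dvd (Int.natAbs_pos.mpr hc) hz).not_gt
    (Nat.lt_pow_self (Fact.out : p.Prime).one_lt)

/-! ## The automorphic half: strong multiplicity one against the newform of `W` -/

/-- Strong multiplicity one, transported: newforms `f ∈ S₂(Γ₀(A))`, `g ∈ S₂(Γ₀(B))` whose Hecke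
eigenvalues agree at all but finitely many primes have the same `q`-expansion (the levels agree by
`IsNewform0.level_eq_of_heckeEigenvalue_eq_holds`, then `f = g` by
`IsNewform0.eq_of_heckeEigenvalue_eq_holds`; stated with variable levels so that the level
identification can be substituted). [cite: AtkinLehner1970, Thm. 4] -/
theorem stubK_qExpansion_coeff_eq_of_heckeEigenvalue_eq {A B : ℕ} [NeZero A] [NeZero B]
    {f : CuspForm (Gamma0 A) 2} {g : CuspForm (Gamma0 B) 2} (hf : IsNewform0 f)
    (hg : IsNewform0 g)
    (hfin : {q : ℕ | q.Prime ∧ heckeEigenvalue f q ≠ heckeEigenvalue g q}.Finite) (m : ℕ) :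
    (qExpansion 1 ⇑f).coeff m = (qExpansion 1 ⇑g).coeff m := by
  obtain rfl : A = B := IsNewform0.level_eq_of_heckeEigenvalue_eq_holds hf hg hfin
  obtain rfl : f = g := IsNewform0.eq_of_heckeEigenvalue_eq_holds hf hg hfin
  rfl

/-- If a newform `g ∈ S₂(Γ₀(N_W·M))` has `a_ℓ(g) = a_ℓ(W)` for every prime `ℓ ∤ N_W·M`, then —
given modularity — its `q`-expansion is `(aₘ(W))ₘ`: the newform `f` of `W` has
`a_ℓ(f) = aₗ(W) = frobeniusTrace W ℓ` at the primes `ℓ ∤ N_W` of good reduction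
(`LFunction_apply_prime_eq_frobeniusTrace`, `dvd_conductorNorm_iff_not_hasGoodReductionAtPrime`,
`heckeEigenvalue_eq_coeff_holds`), so `f` and `g` have the same eigenvalues off the prime divisors
of `N_W·M` and strong multiplicity one identifies them. [cite: AtkinLehner1970, Thm. 4] -/
theorem stubK_qExpansion_coeff_eq_of_forall_heckeEigenvalue_eq (hmod : exists_isNewformOf)
    (W : WeierstrassCurve ℚ) [W.IsElliptic] [W.IsGloballyMinimal]
    (M : ℕ) [NeZero (W.conductorNorm ℤ * M)]
    {g : CuspForm (Gamma0 (W.conductorNorm ℤ * M)) 2} (hg : IsNewform0 g)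
    (hall : ∀ ℓ : ℕ, ℓ.Prime → ¬ ℓ ∣ W.conductorNorm ℤ * M →
      heckeEigenvalue g ℓ = ((W.frobeniusTrace ℓ : ℤ) : ℂ)) (m : ℕ) :
    (qExpansion 1 ⇑g).coeff m = ((W.LFunction m : ℤ) : ℂ) := by
  haveI : NeZero (W.conductorNorm ℤ) :=
    ⟨left_ne_zero_of_mul (NeZero.ne (W.conductorNorm ℤ * M))⟩
  obtain ⟨f, hf⟩ := hmod W
  have hfin : {q : ℕ | q.Prime ∧ heckeEigenvalue f q ≠ heckeEigenvalue g q}.Finite := by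
    refine (Finset.finite_toSet (W.conductorNorm ℤ * M).divisors).subset ?_
    rintro ℓ ⟨hℓ, hne⟩
    rw [Finset.mem_coe, Nat.mem_divisors]
    refine ⟨by_contra fun hℓL ↦ hne ?_, NeZero.ne _⟩
    haveI := Fact.mk hℓ
    have hgood : W.HasGoodReductionAtPrime ℓ := by
      by_contra hbad
      exact hℓL (dvd_mul_of_dvd_left
        ((W.dvd_conductorNorm_iff_not_hasGoodReductionAtPrime ℓ).mpr hbad) M)
    rw [hall ℓ hℓ hℓL, IsNewform0.heckeEigenvalue_eq_coeff_holds hf.1 hℓ,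
      ← W.LFunction_apply_prime_eq_frobeniusTrace ℓ hgood]
    exact hf.2 ℓ
  rw [← stubK_qExpansion_coeff_eq_of_heckeEigenvalue_eq hf.1 hg hfin m]
  exact hf.2 m

/-! ## The stub -/

/-- Stub **K** (depth rigidity, GIVEN modularity). Assuming `exists_isNewformOf`: for `W/ℚ`
globally minimal elliptic, `p` prime, `g ∈ S₂(Γ₀(N_W·M))` a newform whose `q`-expansion is not
`(aₘ(W))ₘ`, there is `n` such that no ring homomorphism `φ : R → ℤ/pⁿ` on a subring `R ⊆ ℂ`
containing the `a_ℓ(g)`, `ℓ ∤ N_W·M`, sends every such `a_ℓ(g)` to `a_ℓ(W) = frobeniusTrace W ℓ`.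
Either some prime `ℓ₀ ∤ N_W·M` has `a_{ℓ₀}(g) ≠ a_{ℓ₀}(W)`, and then the non-zero algebraic integer
`a_{ℓ₀}(g) − a_{ℓ₀}(W)` (Shimura integrality `IsNewform0.isIntegral_coeff_holds` with
`IsNewform0.heckeEigenvalue_eq_coeff_holds`) has bounded depth
(`stubK_exists_depth_of_isIntegral_ne_zero`); or all of them agree, and strong multiplicity one
against the newform of `W` (`stubK_qExpansion_coeff_eq_of_forall_heckeEigenvalue_eq`) contradicts
the `q`-expansion mismatch. [cite: AtkinLehner1970, Thm. 4] -/
theorem stub_depthRigidity : exists_isNewformOf →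
    ∀ (W : WeierstrassCurve ℚ) [W.IsElliptic] [W.IsGloballyMinimal] (p : ℕ) [Fact p.Prime]
      (M : ℕ) [NeZero (W.conductorNorm ℤ * M)]
      (g : CuspForm (CongruenceSubgroup.Gamma0 (W.conductorNorm ℤ * M)) 2),
      IsNewform0 g → (∃ m : ℕ, (qExpansion 1 ⇑g).coeff m ≠ ((W.LFunction m : ℤ) : ℂ)) →
      ∃ n : ℕ, ∀ (R : Subring ℂ) (φ : R →+* ZMod (p ^ n))
        (hR : ∀ ℓ : ℕ, ℓ.Prime → ¬ ℓ ∣ W.conductorNorm ℤ * M → heckeEigenvalue g ℓ ∈ R),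
        ¬ ∀ (ℓ : ℕ) (hℓ : ℓ.Prime) (hℓL : ¬ ℓ ∣ W.conductorNorm ℤ * M),
            φ ⟨heckeEigenvalue g ℓ, hR ℓ hℓ hℓL⟩ = ((W.frobeniusTrace ℓ : ℤ) : ZMod (p ^ n)) := by
  intro hmod W _ _ p _ M _ g hg hmis
  by_cases H : ∃ ℓ₀ : ℕ, ℓ₀.Prime ∧ ¬ ℓ₀ ∣ W.conductorNorm ℤ * M ∧
      heckeEigenvalue g ℓ₀ ≠ ((W.frobeniusTrace ℓ₀ : ℤ) : ℂ)
  · obtain ⟨ℓ₀, hℓ₀, hℓ₀L, hne⟩ := H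
    have hint : IsIntegral ℤ (heckeEigenvalue g ℓ₀ - ((W.frobeniusTrace ℓ₀ : ℤ) : ℂ)) := by
      rw [IsNewform0.heckeEigenvalue_eq_coeff_holds hg hℓ₀]
      exact (IsNewform0.isIntegral_coeff_holds hg ℓ₀).sub isIntegral_algebraMap
    obtain ⟨n, hn⟩ := stubK_exists_depth_of_isIntegral_ne_zero p hint (sub_ne_zero.mpr hne)
    refine ⟨n, fun R φ hR hall ↦ ?_⟩
    have hxR : heckeEigenvalue g ℓ₀ - ((W.frobeniusTrace ℓ₀ : ℤ) : ℂ) ∈ R :=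
      sub_mem (hR ℓ₀ hℓ₀ hℓ₀L) (intCast_mem R _)
    refine hn R φ hxR ?_
    have hy : (⟨_, hxR⟩ : R) =
        ⟨heckeEigenvalue g ℓ₀, hR ℓ₀ hℓ₀ hℓ₀L⟩ - ((W.frobeniusTrace ℓ₀ : ℤ) : R) :=
      Subtype.ext rfl
    rw [hy, map_sub, map_intCast, hall ℓ₀ hℓ₀ hℓ₀L, sub_self]
  · push Not at H
    obtain ⟨m, hm⟩ := hmis
    exact (hm (stubK_qExpansion_coeff_eq_of_forall_heckeEigenvalue_eq hmod W M hg H m)).elim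

end Summit.BirchSwinnertonDyer.BirchSwinnertonDyer.Theorems

end
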